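import Summits.PneNP.PneNP.Theorems.ResolutionUncertainty.Negative.BruteForce
import Literature.Combinatorics.SimpleGraph.RamseyNumbers

/-!
# Ramsey graphs with few cliques AND few independent sets (first moment over all edge sets)

Calibration lemma for the support item `Summit.PneNP.PneNP.Theses.RamseyUncertifiable.ResolutionUncertainty`
(stmt-PneNP-9816), ported from the cdisprove workfile `Cruxes/ResolutionUncertainty/Disproof.lean` (statements and
proofs unchanged): Erdős's 1947 count refined by a first-moment bound on the number of CONSISTENT block
assignments (`BruteForce.Consistent`: ordered cliques for polarity `true`, ordered independent sets for `false`).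

* `exists_ramsey_few_cliques` (registered stub) — if `4·C(n,k) < 2^{C(k,2)}` (`k ≤ n+1`, `n ≥ 1`), some graph
  on `Fin n` has no homogeneous `k`-set and, for every `t ≤ k` and both polarities, at most
  `8(k+1)·n^t / 2^{C(t,2)}` consistent block assignments of length `t`.
Ingredients: `card_filter_consistent_le` (a fixed injective `s` is consistent for `≤ 2·2^{N−C(t,2)}` edge sets),
`sum_card_cons_le` (double counting), `card_bad_le` (Markov), `card_filter_homogeneous_le` (the union bound of the
tree's `erdos1947_ramsey_lower_holds`, for an arbitrary predicate implying a homogeneous `k`-set). Used by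
`HalfBoundary.lean` (`ε ≤ 1/2` in the item). [Erdos1947; folklore]
-/

-- the mandated namespace `Summit.PneNP.PneNP.…` (summit = problem = `PneNP`) repeats `PneNP` by design
set_option linter.dupNamespace false

namespace Summit.PneNP.PneNP.Theorems.ResolutionUncertainty.Negative

open Literature.Computability.Complexity Literature.Computability.MetaComplexity

section Counting

open Finset

variable {n : ℕ}

/-- Adjacency (polarity `b = true`) / non-adjacency (`b = false`) in the graph with edge set `E`
(diagonal pairs inert). -/
def adjP (b : Bool) (E : Finset (Sym2 (Fin n))) (u v : Fin n) : Bool :=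
  decide ((s(u, v) ∈ E ↔ b = true) ∧ u ≠ v)

/-- The graph with edge set `E`. -/
def gr (E : Finset (Sym2 (Fin n))) : SimpleGraph (Fin n) :=
  SimpleGraph.fromEdgeSet (↑E : Set (Sym2 (Fin n)))

/-- Adjacency of `gr E` is decidable. -/
instance (E : Finset (Sym2 (Fin n))) : DecidableRel (gr E).Adj := by
  unfold gr; infer_instance

/-- The decided adjacency of `gr E` is `adjP true E`. -/
theorem decide_gr_adj (E : Finset (Sym2 (Fin n))) [DecidableRel (gr E).Adj] :
    (fun u v => decide ((gr E).Adj u v)) = adjP true E := by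
  funext u v
  rw [adjP, Bool.eq_iff_iff]
  simp [gr, SimpleGraph.fromEdgeSet_adj]

/-- The decided adjacency of `(gr E)ᶜ` is `adjP false E`. -/
theorem decide_gr_compl_adj (E : Finset (Sym2 (Fin n))) [DecidableRel (gr E).Adj] :
    (fun u v => decide ((gr E)ᶜ.Adj u v)) = adjP false E := by
  funext u v
  rw [adjP, Bool.eq_iff_iff]
  simp only [SimpleGraph.compl_adj, gr, SimpleGraph.fromEdgeSet_adj, Finset.mem_coe,
    decide_eq_true_eq, Bool.false_eq_true, iff_false, ne_eq]
  tauto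

/-- The `C(t,2)` pairs inside the image of a block assignment. -/
def pairsOf {t : ℕ} (s : Fin t → Fin n) : Finset (Sym2 (Fin n)) :=
  ((univ : Finset (Fin t)).image s).offDiag.image (Function.uncurry Sym2.mk)

/-- An injective `s : Fin t → Fin n` spans `C(t,2)` pairs. -/
theorem card_pairsOf {t : ℕ} {s : Fin t → Fin n} (hs : Function.Injective s) :
    (pairsOf s).card = t.choose 2 := by
  rw [pairsOf, Sym2.card_image_offDiag, card_image_of_injective _ hs, card_univ, Fintype.card_fin]

/-- Consistent assignments are injective (the diagonal is inert). -/
theorem injective_of_consistent {b : Bool} {t : ℕ} {s : Fin t → Fin n} {E : Finset (Sym2 (Fin n))}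
    (h : Consistent (adjP b E) s) : Function.Injective s := by
  intro a c hac
  by_contra hne
  have := h a c hne
  simp [adjP, hac] at this

/-- The pairs of a consistent assignment lie inside `E` (polarity `true`) or avoid it (`false`). -/
theorem pairsOf_subset_or_disjoint {b : Bool} {t : ℕ} {s : Fin t → Fin n}
    {E : Finset (Sym2 (Fin n))} (h : Consistent (adjP b E) s) :
    pairsOf s ⊆ E ∨ Disjoint (pairsOf s) E := by
  have key : ∀ e ∈ pairsOf s, (e ∈ E ↔ b = true) := by
    intro e he
    simp only [pairsOf, mem_image, mem_offDiag, mem_univ, true_and, Prod.exists,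
      Function.uncurry_apply_pair] at he
    obtain ⟨x, y, ⟨⟨a, rfl⟩, ⟨c, rfl⟩, hne⟩, rfl⟩ := he
    have hac : a ≠ c := fun e => hne (by rw [e])
    have := h a c hac
    simp only [adjP, decide_eq_true_eq] at this
    exact this.1
  cases b
  · exact Or.inr (disjoint_left.2 fun e he heE => by simpa using (key e he).1 heE)
  · exact Or.inl fun e he => (key e he).2 rfl

/-- For a fixed block assignment `s`, at most `2 · 2^{N - C(t,2)}` edge sets make `s` consistent
(as cliques for `b = true`, as independent sets for `b = false`). -/
theorem card_filter_consistent_le (b : Bool) {t : ℕ} (s : Fin t → Fin n) :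
    ((univ : Finset (Sym2 (Fin n))).powerset.filter fun E => Consistent (adjP b E) s).card ≤
      2 * 2 ^ ((univ : Finset (Sym2 (Fin n))).card - t.choose 2) := by
  by_cases hs : Function.Injective s
  · rw [← card_pairsOf hs]
    refine le_trans (card_le_card ?_) ((card_union_le _ _).trans
      (Literature.Combinatorics.SimpleGraph.card_filter_superset_add_card_filter_disjoint_le
        univ (pairsOf s) (subset_univ _)))
    intro E hE
    rw [mem_filter] at hE
    rw [mem_union, mem_filter, mem_filter]
    rcases pairsOf_subset_or_disjoint hE.2 with h | h
    · exact Or.inl ⟨hE.1, h⟩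
    · exact Or.inr ⟨hE.1, h⟩
  · have : ((univ : Finset (Sym2 (Fin n))).powerset.filter fun E => Consistent (adjP b E) s) = ∅ :=
      filter_eq_empty_iff.2 fun E _ hE => hs (injective_of_consistent hE)
    rw [this, card_empty]
    exact Nat.zero_le _

/-- Double counting: `Σ_E C_t(E) ≤ n^t · 2 · 2^{N - C(t,2)}`. -/
theorem sum_card_cons_le (b : Bool) (t : ℕ) :
    ∑ E ∈ (univ : Finset (Sym2 (Fin n))).powerset, (cons (adjP b E) t).card ≤
      n ^ t * (2 * 2 ^ ((univ : Finset (Sym2 (Fin n))).card - t.choose 2)) := by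
  calc ∑ E ∈ (univ : Finset (Sym2 (Fin n))).powerset, (cons (adjP b E) t).card
      = ∑ E ∈ (univ : Finset (Sym2 (Fin n))).powerset, ∑ s : Fin t → Fin n,
          (if Consistent (adjP b E) s then 1 else 0) := by
        refine sum_congr rfl fun E _ => ?_
        rw [cons, card_filter]
    _ = ∑ s : Fin t → Fin n, ∑ E ∈ (univ : Finset (Sym2 (Fin n))).powerset,
          (if Consistent (adjP b E) s then 1 else 0) := sum_comm
    _ = ∑ s : Fin t → Fin n,
          ((univ : Finset (Sym2 (Fin n))).powerset.filter fun E => Consistent (adjP b E) s).card := by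
        refine sum_congr rfl fun s _ => ?_
        rw [card_filter]
    _ ≤ ∑ _s : Fin t → Fin n, 2 * 2 ^ ((univ : Finset (Sym2 (Fin n))).card - t.choose 2) :=
        sum_le_sum fun s _ => card_filter_consistent_le b s
    _ = n ^ t * (2 * 2 ^ ((univ : Finset (Sym2 (Fin n))).card - t.choose 2)) := by
        rw [sum_const, card_univ, smul_eq_mul, Fintype.card_fun, Fintype.card_fin, Fintype.card_fin]

/-- Markov's inequality, finitary. -/
theorem card_filter_lt_mul_le {ι : Type*} (S : Finset ι) (f : ι → ℕ) (A : ℕ) :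
    (S.filter fun i => A < f i).card * A ≤ ∑ i ∈ S, f i := by
  calc (S.filter fun i => A < f i).card * A = ∑ _i ∈ S.filter (fun i => A < f i), A := by
        rw [sum_const, smul_eq_mul]
    _ ≤ ∑ i ∈ S.filter (fun i => A < f i), f i := sum_le_sum fun i hi => (mem_filter.1 hi).2.le
    _ ≤ ∑ i ∈ S, f i := sum_le_sum_of_subset (filter_subset _ _)

/-- The edge sets with too many consistent `t`-assignments are few:
`4(k+1) · #bad_t ≤ 2^N`. -/
theorem card_bad_le (b : Bool) (k t : ℕ) (ht : t.choose 2 ≤ (univ : Finset (Sym2 (Fin n))).card)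
    (hn : 0 < n) :
    4 * (k + 1) * ((univ : Finset (Sym2 (Fin n))).powerset.filter fun E =>
        8 * (k + 1) * n ^ t < 2 ^ t.choose 2 * (cons (adjP b E) t).card).card ≤
      2 ^ (univ : Finset (Sym2 (Fin n))).card := by
  set U := (univ : Finset (Sym2 (Fin n))) with hU
  have h1 := card_filter_lt_mul_le U.powerset (fun E => 2 ^ t.choose 2 * (cons (adjP b E) t).card)
    (8 * (k + 1) * n ^ t)
  have h2 : ∑ E ∈ U.powerset, 2 ^ t.choose 2 * (cons (adjP b E) t).card ≤
      2 ^ t.choose 2 * (n ^ t * (2 * 2 ^ (U.card - t.choose 2))) := by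
    rw [← mul_sum]
    exact Nat.mul_le_mul_left _ (sum_card_cons_le b t)
  have h3 : 2 ^ t.choose 2 * (n ^ t * (2 * 2 ^ (U.card - t.choose 2))) = 2 ^ U.card * (2 * n ^ t) := by
    rw [show 2 ^ U.card = 2 ^ t.choose 2 * 2 ^ (U.card - t.choose 2) by
      rw [← pow_add, Nat.add_sub_cancel' ht]]
    ring
  have hpos : 0 < 2 * n ^ t := by positivity
  refine Nat.le_of_mul_le_mul_right ?_ hpos
  calc 4 * (k + 1) * (U.powerset.filter fun E =>
          8 * (k + 1) * n ^ t < 2 ^ t.choose 2 * (cons (adjP b E) t).card).card * (2 * n ^ t)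
      = (U.powerset.filter fun E =>
          8 * (k + 1) * n ^ t < 2 ^ t.choose 2 * (cons (adjP b E) t).card).card *
          (8 * (k + 1) * n ^ t) := by ring
    _ ≤ _ := h1
    _ ≤ _ := h2
    _ = 2 ^ U.card * (2 * n ^ t) := h3

/-- The edge sets whose graph has a homogeneous `k`-set number at most `C(n,k) · 2 · 2^{N-C(k,2)}`
(the count inside the tree's `erdos1947_ramsey_lower_holds`, for an arbitrary decidable `P`
implying homogeneity). -/
theorem card_filter_homogeneous_le (k : ℕ) (P : Finset (Sym2 (Fin n)) → Prop) [DecidablePred P]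
    (hP : ∀ E, P E → ∃ S : Finset (Fin n), (gr E).IsNClique k S ∨ (gr E)ᶜ.IsNClique k S) :
    ((univ : Finset (Sym2 (Fin n))).powerset.filter P).card ≤
      n.choose k * (2 * 2 ^ ((univ : Finset (Sym2 (Fin n))).card - k.choose 2)) := by
  set U := (univ : Finset (Sym2 (Fin n))) with hU
  set T : Finset (Fin n) → Finset (Sym2 (Fin n)) :=
    fun S => S.offDiag.image (Function.uncurry Sym2.mk) with hT
  have hcover : U.powerset.filter P ⊆
      ((univ : Finset (Fin n)).powersetCard k).biUnion fun S =>
        (U.powerset.filter fun E => T S ⊆ E) ∪ (U.powerset.filter fun E => Disjoint (T S) E) := by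
    intro E hE
    rw [mem_filter] at hE
    obtain ⟨S, hS⟩ := hP E hE.2
    have hSk : S.card = k := by
      rcases hS with hS | hS
      · exact hS.card_eq
      · exact hS.card_eq
    rw [mem_biUnion]
    refine ⟨S, mem_powersetCard.mpr ⟨subset_univ _, hSk⟩, ?_⟩
    rw [mem_union, mem_filter, mem_filter]
    rcases Literature.Combinatorics.SimpleGraph.pairs_subset_or_disjoint_of_homogeneous E S hS
      with h | h
    · exact Or.inl ⟨hE.1, h⟩
    · exact Or.inr ⟨hE.1, h⟩
  refine (card_le_card hcover).trans (card_biUnion_le.trans ?_)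
  have hnk : ((univ : Finset (Fin n)).powersetCard k).card = n.choose k := by
    rw [card_powersetCard, card_univ, Fintype.card_fin]
  rw [← hnk, ← smul_eq_mul, ← sum_const]
  refine sum_le_sum fun S hS => ?_
  have hTS : (T S).card = k.choose 2 := by
    rw [hT, Sym2.card_image_offDiag, (mem_powersetCard.mp hS).2]
  rw [← hTS]
  exact (card_union_le _ _).trans
    (Literature.Combinatorics.SimpleGraph.card_filter_superset_add_card_filter_disjoint_le _ (T S)
      (subset_univ _))


/-- **Ramsey graphs with few cliques and few independent sets.** If `4 C(n,k) < 2^{C(k,2)}`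
(`k ≤ n + 1`, `n ≥ 1`), some graph on `Fin n` has no homogeneous `k`-set and, for every `t ≤ k`,
at most `8(k+1) n^t / 2^{C(t,2)}` consistent block assignments of length `t` on either side
(registered stub, binder-free). -/
theorem exists_ramsey_few_cliques :
    ∀ {n : ℕ} (k : ℕ), 0 < n → k ≤ n + 1 → 4 * n.choose k < 2 ^ k.choose 2 → ∃ E : Finset (Sym2 (Fin n)), ((gr E).CliqueFree k ∧ (gr E)ᶜ.CliqueFree k) ∧ ∀ b : Bool, ∀ t ≤ k, 2 ^ t.choose 2 * (cons (adjP b E) t).card ≤ 8 * (k + 1) * n ^ t := by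
  intro n k hn hk hnum
  classical
  set U := (univ : Finset (Sym2 (Fin n))) with hU
  have hUcard : U.card = (n + 1).choose 2 := by
    rw [hU, card_univ, Sym2.card, Fintype.card_fin]
  have hkN : k.choose 2 ≤ U.card := hUcard ▸ Nat.choose_le_choose 2 hk
  -- the bad families
  set nonR := U.powerset.filter fun E => ¬ ((gr E).CliqueFree k ∧ (gr E)ᶜ.CliqueFree k) with hnonR
  set bad : Bool → ℕ → Finset (Finset (Sym2 (Fin n))) := fun b t =>
    U.powerset.filter fun E => 8 * (k + 1) * n ^ t < 2 ^ t.choose 2 * (cons (adjP b E) t).card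
    with hbad
  set Bad := nonR ∪ (range (k + 1)).biUnion fun t => bad true t ∪ bad false t with hBad
  -- counts
  have h1 : 4 * nonR.card < 2 * 2 ^ U.card := by
    have hc := card_filter_homogeneous_le (n := n) k
      (fun E => ¬ ((gr E).CliqueFree k ∧ (gr E)ᶜ.CliqueFree k)) (fun E hE => by
        by_cases hc : (gr E).CliqueFree k
        · have h' : ¬ (gr E)ᶜ.CliqueFree k := fun h'' => hE ⟨hc, h''⟩
          simp only [SimpleGraph.CliqueFree, not_forall, not_not] at h'
          obtain ⟨S, hS⟩ := h'
          exact ⟨S, Or.inr hS⟩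
        · simp only [SimpleGraph.CliqueFree, not_forall, not_not] at hc
          obtain ⟨S, hS⟩ := hc
          exact ⟨S, Or.inl hS⟩)
    calc 4 * nonR.card ≤ 4 * (n.choose k * (2 * 2 ^ (U.card - k.choose 2))) :=
          Nat.mul_le_mul_left 4 hc
      _ = (4 * n.choose k) * (2 * 2 ^ (U.card - k.choose 2)) := by ring
      _ < 2 ^ k.choose 2 * (2 * 2 ^ (U.card - k.choose 2)) :=
          Nat.mul_lt_mul_of_pos_right hnum (by positivity)
      _ = 2 * 2 ^ U.card := by
          rw [show 2 ^ U.card = 2 ^ k.choose 2 * 2 ^ (U.card - k.choose 2) by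
            rw [← pow_add, Nat.add_sub_cancel' hkN]]
          ring
  have h2 : ∀ b, ∀ t ∈ range (k + 1), 4 * (k + 1) * (bad b t).card ≤ 2 ^ U.card := by
    intro b t ht
    have htk : t ≤ k := Nat.lt_succ_iff.1 (mem_range.1 ht)
    exact card_bad_le b k t ((Nat.choose_le_choose 2 (htk.trans hk)).trans (hUcard ▸ le_rfl)) hn
  have h3 : 4 * ((range (k + 1)).biUnion fun t => bad true t ∪ bad false t).card ≤ 2 * 2 ^ U.card := by
    have hsum : (k + 1) * (4 * ((range (k + 1)).biUnion fun t => bad true t ∪ bad false t).card) ≤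
        (k + 1) * (2 * 2 ^ U.card) := by
      calc (k + 1) * (4 * ((range (k + 1)).biUnion fun t => bad true t ∪ bad false t).card)
          ≤ (k + 1) * (4 * ∑ t ∈ range (k + 1), ((bad true t).card + (bad false t).card)) := by
            gcongr
            exact card_biUnion_le.trans (sum_le_sum fun t _ => card_union_le _ _)
        _ = ∑ t ∈ range (k + 1), (4 * (k + 1) * (bad true t).card + 4 * (k + 1) * (bad false t).card) := by
            rw [mul_sum, mul_sum]
            refine sum_congr rfl fun t _ => by ring
        _ ≤ ∑ _t ∈ range (k + 1), (2 ^ U.card + 2 ^ U.card) :=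
            sum_le_sum fun t ht => Nat.add_le_add (h2 true t ht) (h2 false t ht)
        _ = (k + 1) * (2 * 2 ^ U.card) := by rw [sum_const, card_range, smul_eq_mul]; ring
    exact Nat.le_of_mul_le_mul_left hsum (Nat.succ_pos k)
  have hBadlt : Bad.card < U.powerset.card := by
    rw [card_powerset, hBad]
    have := card_union_le nonR ((range (k + 1)).biUnion fun t => bad true t ∪ bad false t)
    omega
  obtain ⟨E, hEU, hEBad⟩ := exists_mem_notMem_of_card_lt_card hBadlt
  rw [hBad, mem_union, not_or, mem_biUnion] at hEBad
  obtain ⟨hE1, hE2⟩ := hEBad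
  refine ⟨E, ?_, ?_⟩
  · by_contra hR
    exact hE1 (mem_filter.2 ⟨hEU, hR⟩)
  · intro b t ht
    by_contra hlt
    push Not at hlt
    refine hE2 ⟨t, mem_range.2 (Nat.lt_succ_of_le ht), ?_⟩
    rw [mem_union]
    cases b
    · exact Or.inr (mem_filter.2 ⟨hEU, hlt⟩)
    · exact Or.inl (mem_filter.2 ⟨hEU, hlt⟩)

end Counting

end Summit.PneNP.PneNP.Theorems.ResolutionUncertainty.Negative
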